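import Mathlib
import Literature.NumberTheory.LFunctions.WeilFirstPrimeCertificateZ
import Literature.NumberTheory.LFunctions.WeilFirstPrimeQuadratic
import HarnessLib

/-!
# Soundness of the odd-sector margin certificate

Stub `stub_oddMarginSound` for the line *parity–multiplicity–commutator* of the crux
`GroundStateSimpleEven` (Weil ground state). The kernel-checked Stage-C certificate format
`WeilCert3` of first-prime Weil positivity proves `E₂(g) ≥ 0` on `C(b)`
(`WeilCert3.weilFirstPrimeQuadratic_nonneg_of_check`): Taylor expansion of the polar and frequency
sides in the moments `M_k = ∫ g (x/a₀)^k`, a certified minorant, rounding, and the algebraic core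
`Σ P_r z + κ · Bessel = Σ_p Re y_p* S'_p y_p ≥ 0` over the two parity blocks `p = 0, 1`. For an ODD
test function the even moments vanish, so only the odd block is needed (`oms_core_nonnegK_odd`), and
running the Bessel step with a smaller coefficient `κ' ≤ κ` leaves the margin
`(κ − κ') ‖g‖₂² ≤ E₂(g)`. The analytic reduction `Σ P_r z + κ ‖g‖₂² ≤ E₂(g)` (`oms_step3`, valid for
all `g`) is the proof of `WeilCert3.weilFirstPrimeQuadratic_nonneg_of_check` verbatim up to its last
step.
-/

open Complex Finset MeasureTheory Set Filter
open scoped Real Topology ComplexConjugate BigOperators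

open Literature.NumberTheory.LFunctions
open Literature.Analysis.ValidatedNumerics.Numerics Literature.Analysis.SpecialFunctions

namespace Summit.RiemannHypothesis.RiemannHypothesis.Theorems

namespace GroundStateSimpleEven

set_option linter.dupNamespace false in
/-- Odd functions have vanishing even moments: `∫ g(x) (x/a)^{2i} dx = 0` if `g(-x) = -g(x)`. [folklore] -/
theorem oms_weilMoment_even {g : ℝ → ℂ} (hodd : ∀ x, g (-x) = -g x) (a : ℝ) (i : ℕ) :
    weilMoment a g (2 * i) = 0 := by
  have h := integral_neg_eq_self (fun x : ℝ ↦ g x * ((((x / a) ^ (2 * i) : ℝ)) : ℂ)) volume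
  have h2 : ∀ x : ℝ, g (-x) * ((((-x / a) ^ (2 * i) : ℝ)) : ℂ) =
      -(g x * ((((x / a) ^ (2 * i) : ℝ)) : ℂ)) := fun x ↦ by
    rw [hodd, neg_div, (even_two_mul i).neg_pow, neg_mul]
  simp only [h2, integral_neg] at h
  unfold weilMoment
  linear_combination (-(1 : ℂ) / 2) * h

set_option linter.dupNamespace false in
/-- **The algebraic core on the odd block.** If the even entries of `M` vanish, then with
`N + 1 = 2 nb` and only the ODD block checked (`checkBlockK nu κ 1`), the reduced form plus `κ ×` the
Bessel expression is `Re y₁* S'₁ y₁ ≥ 0` (the even block contributes nothing: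
`y₀ = 0`, `u(2i) = 0`). [folklore] -/
theorem oms_core_nonnegK_odd {c : WeilCert} {nu : List ℚ} {κ : ℚ} (hN : c.N + 1 = 2 * c.nb)
    (hb1 : c.checkBlockK nu κ 1 = true) (a : ℝ) (ha : (c.a0 : ℝ) = a) (M : ℕ → ℂ)
    (hM : ∀ i, M (2 * i) = 0) :
    0 ≤ (∑ k ∈ range (c.N + 1), ∑ l ∈ range (c.N + 1),
        (c.prQ nu k l : ℝ) * (conj (M k) * M l).re) +
      (κ : ℝ) *
        (2 * (∑ k ∈ range (c.N + 1), conj (c.uVec M k) * M k).re -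
          (∑ k ∈ range (c.N + 1), ∑ l ∈ range (c.N + 1),
            conj (c.uVec M k) * c.uVec M l * (gramH a k l : ℂ)).re) := by
  have hDC1 : c.checkDC 1 = true := by
    unfold WeilCert.checkBlockK at hb1; rw [Bool.and_eq_true] at hb1; exact hb1.1
  -- the even coordinates vanish
  have hy0 : ∀ j, c.yVec M 0 j = 0 := fun j ↦ by
    unfold WeilCert.yVec
    exact Finset.sum_eq_zero fun i _ ↦ by rw [add_zero, hM, mul_zero]
  have hu0 : ∀ i, c.uVec M (2 * i) = 0 := fun i ↦ by
    have h := WeilCert.uVec_block (c := c) M 0 i (by norm_num)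
    rw [add_zero] at h
    rw [h]
    exact Finset.sum_eq_zero fun j _ ↦ by rw [hy0, mul_zero]
  -- rewrite everything as the real part of one complex expression
  have key : (∑ k ∈ range (c.N + 1), ∑ l ∈ range (c.N + 1),
        (c.prQ nu k l : ℝ) * (conj (M k) * M l).re) +
      (κ : ℝ) *
        (2 * (∑ k ∈ range (c.N + 1), conj (c.uVec M k) * M k).re -
          (∑ k ∈ range (c.N + 1), ∑ l ∈ range (c.N + 1),
            conj (c.uVec M k) * c.uVec M l * (gramH a k l : ℂ)).re) =
      ((∑ k ∈ range (c.N + 1), ∑ l ∈ range (c.N + 1),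
          (c.prQ nu k l : ℂ) * (conj (M k) * M l)) +
        (κ : ℂ) *
          (2 * ∑ k ∈ range (c.N + 1), conj (c.uVec M k) * M k -
            ∑ k ∈ range (c.N + 1), ∑ l ∈ range (c.N + 1),
              conj (c.uVec M k) * c.uVec M l * (gramH a k l : ℂ))).re := by
    have e1 : (∑ k ∈ range (c.N + 1), ∑ l ∈ range (c.N + 1),
        (c.prQ nu k l : ℂ) * (conj (M k) * M l)).re =
        ∑ k ∈ range (c.N + 1), ∑ l ∈ range (c.N + 1), (c.prQ nu k l : ℝ) * (conj (M k) * M l).re := by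
      rw [Complex.re_sum]
      refine Finset.sum_congr rfl fun k _ ↦ ?_
      rw [Complex.re_sum]
      refine Finset.sum_congr rfl fun l _ ↦ ?_
      rw [show ((c.prQ nu k l : ℚ) : ℂ) = (((c.prQ nu k l : ℚ) : ℝ) : ℂ) by norm_cast,
        Complex.re_ofReal_mul]
    have e2 : ∀ (κ : ℚ) (X Y : ℂ), ((κ : ℂ) * (2 * X - Y)).re = (κ : ℝ) * (2 * X.re - Y.re) := by
      intro κ X Y
      rw [show ((κ : ℚ) : ℂ) = (((κ : ℚ) : ℝ) : ℂ) by norm_cast, Complex.re_ofReal_mul]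
      congr 1
      simp [Complex.mul_re]
    rw [Complex.add_re, e1, e2]
  rw [key]
  -- parity split
  have hH : ∀ k l, k % 2 ≠ l % 2 → (gramH a k l : ℂ) = 0 := by
    intro k l hkl
    have hodd : Odd (k + l) := by
      rcases Nat.even_or_odd k with hk | hk <;> rcases Nat.even_or_odd l with hl | hl
      · exact absurd (by rw [Nat.even_iff.1 hk, Nat.even_iff.1 hl]) hkl
      · exact hk.add_odd hl
      · exact hk.add_even hl
      · exact absurd (by rw [Nat.odd_iff.1 hk, Nat.odd_iff.1 hl]) hkl
    rw [gramH, hodd.neg_one_pow]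
    simp
  rw [hN, WeilAlg.sum_sum_range_two_mul c.nb _ (fun k l hkl ↦ by
      rw [WeilCert.prQ_cross nu hkl]; simp),
    WeilAlg.sum_range_two_mul c.nb,
    WeilAlg.sum_sum_range_two_mul c.nb _ (fun k l hkl ↦ by rw [hH k l hkl]; simp)]
  -- the Gram entries on the odd block
  have hG1 : ∀ i i', (gramH a (2 * i + 1) (2 * i' + 1) : ℂ) = (c.hBlkQ 1 i i' : ℂ) := by
    intro i i'
    have hev : Even (2 * i + 1 + (2 * i' + 1)) := ⟨i + i' + 1, by ring⟩
    rw [gramH, hev.neg_one_pow, WeilCert.hBlkQ, ← ha]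
    push_cast
    ring
  simp_rw [hG1]
  have e1 := WeilCert.block_identityK (c := c) (nu := nu) κ (p := 1) (by norm_num) hDC1 M
  -- the even block vanishes
  simp only [hM, hu0, map_zero, zero_mul, mul_zero, Finset.sum_const_zero, zero_add]
  rw [e1]
  exact WeilAlg.re_herm_nonneg c.nb _ (fun x ↦ WeilCert.spFunK_quad_nonneg hb1 x) _

set_option maxHeartbeats 1600000 in
set_option linter.dupNamespace false in
/-- **The analytic reduction of the Stage-C certificate** (the proof of
`WeilCert3.weilFirstPrimeQuadratic_nonneg_of_check` up to its last step, for every test function):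
if the cells, scalar and moment checks pass then `Σ_{k,l ≤ N} P_r(k,l) Re(conj M_k M_l) + κ ‖g‖₂² ≤ E₂(g)`
on `C(b)`. [folklore] -/
theorem oms_step3 {c : WeilCert3}
    (hcells3 : checkCells₃ c.base.prec c.j c.base.wL c.base.T c.base.mwT c.cells = true)
    (hsc : c.checkScalars = true) (hnuchk : c.checkNu = true) {g : ℝ → ℂ} (hg : IsWeilTest g)
    (hsupp : tsupport g ⊆ Icc (-(c.b : ℝ)) c.b) :
    ∑ k ∈ range (c.base.N + 1), ∑ l ∈ range (c.base.N + 1),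
        ((c.base.prQ c.nuTab k l : ℚ) : ℝ) *
          (conj (weilMoment c.base.a0 g k) * weilMoment c.base.a0 g l).re +
      ((c.kappaQ : ℚ) : ℝ) * weilNorm2Sq g ≤ weilFirstPrimeQuadratic g := by
  unfold weilFirstPrimeQuadratic weilFirstPrimeWeight
  have hcells : CellsOK c.base.wL c.base.T c.cells := cellsOK_of_checkCells₃ hcells3
  obtain ⟨-, hbpos, hba, ha1q, -, -, -, hN, -⟩ := WeilCert3.scalars_spec hsc
  set a : ℝ := (c.base.a0 : ℝ) with ha_def
  have hba' : ((c.b : ℚ) : ℝ) ≤ a := by rw [ha_def]; exact_mod_cast hba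
  have hb0' : (0 : ℝ) < c.b := by exact_mod_cast hbpos
  have ha : 0 < a := by linarith
  have ha1 : a ≤ 1 := by rw [ha_def]; exact_mod_cast ha1q
  have hsupp' : tsupport g ⊆ Icc (-a) a := hsupp.trans (Icc_subset_Icc (by linarith) hba')
  set n := c.base.N + 1 with hn
  set nu := c.nuTab with hnu
  set M : ℕ → ℂ := weilMoment a g with hM
  set L := weilNorm1 g with hL
  set N2 := weilNorm2Sq g with hN2
  set z : ℕ → ℕ → ℝ := fun k l ↦ (conj (M k) * M l).re with hz
  have hzsym : ∀ k l, z k l = z l k := fun k l ↦ by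
    rw [hz]; simp only; rw [← WeilAna.re_mul_conj_eq, mul_comm]
  have hL0 : 0 ≤ L := weilNorm1_nonneg g
  have hN20 : 0 ≤ N2 := weilNorm2Sq_nonneg g
  have hL1 : L ^ 2 ≤ 2 * a * N2 := weilNorm1_sq_le hg ha hsupp'
  -- the three terms of E(g)
  set P : ℝ := 2 * (weilMellin g 0 * conj (weilMellin g 1)).re with hP
  set A : ℝ := ∫ t : ℝ, ‖weilMellin g (1 / 2 + t * I)‖ ^ 2 *
    (Literature.Analysis.SpecialFunctions.reDigammaQuarter t - Real.sqrt 2 * Real.log 2 * Real.cos (t * Real.log 2)) with hA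
  set Γ : ℝ := ∫ t : ℝ, ‖weilMellin g (1 / 2 + t * I)‖ ^ 2 * cellsGamma₂ c.base.wL c.cells t with hΓ
  -- Step A
  set ρ : ℝ := 2 * (a / 2) ^ (c.base.N + 1) / (c.base.N + 1).factorial with hρ
  have hρ0 : 0 ≤ ρ := by positivity
  have hPA : ∑ k ∈ range n, ∑ l ∈ range n,
      (2 * ((-a / 2) ^ k / k.factorial) * ((a / 2) ^ l / l.factorial)) * z k l -
      (8 * ρ + 6 * ρ ^ 2) * L ^ 2 ≤ P := WeilAna.polar_lower_bound hg ha ha1 hsupp' c.base.N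
  rw [WeilCert.polar_symmetrize n a z hzsym] at hPA
  -- Step B
  have hB : (c.base.wL : ℝ) * (2 * π * N2) - Γ ≤ A := WeilCert3.arch_lower_bound hcells hg
  -- Step C
  have hC : Γ ≤ ∑ k ∈ range n, ∑ l ∈ range n, WeilCert3.gHat c k l * z k l +
      5 * L ^ 2 * (c.nuPrimeAbs : ℝ) := by
    have := WeilCert3.freq_integral_bound hcells hsc hg (by rwa [← ha_def])
    rw [← ha_def] at this
    exact this
  -- constants
  set q : ℝ := ((invTwoPiHi20 : ℚ) : ℝ) with hq
  set qLo : ℝ := ((invTwoPiLo20 : ℚ) : ℝ) with hqLo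
  have hq1 : 1 / (2 * π) ≤ q := invTwoPiHi20_ge
  have hq0 : 0 ≤ q := invTwoPiHi20_nonneg
  have hqLo1 : qLo ≤ 1 / (2 * π) := invTwoPiLo20_le
  have hlogpi : Real.log π ≤ ((logPiHi20 : ℚ) : ℝ) := logPiHi20_ge
  have hν0 : 0 ≤ ((c.nuPrimeAbs : ℚ) : ℝ) := by
    unfold WeilCert3.nuPrimeAbs
    have h1 : (0 : ℝ) ≤ (cellsAbsMomentQ c.base.wL c.cells (c.base.N + 1) : ℝ) := by
      rw [← (integral_stepAux_mul_powV (wL := c.base.wL) hcells.valid (c.base.N + 1)).2]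
      refine integral_nonneg fun s' ↦ mul_nonneg ((stepAux_propsV (wL := c.base.wL)
        hcells.valid).1.choose_spec s').1 ?_
      have hev : Even (c.base.N + 1) := ⟨c.base.nb, by omega⟩
      rw [← hev.pow_abs]; positivity
    push_cast
    have ha0 : (0 : ℝ) ≤ (c.base.a0 : ℝ) := by rw [← ha_def]; exact ha.le
    positivity
  have hpi : 0 < 1 / (2 * π) := by positivity
  -- the signed `Γ`: `−(1/2π)Γ ≥ −qX − (q − qLo)·C₀·7·N2`
  set C₀ : ℝ := ((cellsBndMaxQ c.base.wL c.cells : ℚ) : ℝ) with hC₀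
  have hC₀0 : 0 ≤ C₀ := by rw [hC₀]; exact_mod_cast cellsBndMaxQ_nonneg c.base.wL c.cells
  have hγabs : ∀ t, |cellsGamma₂ c.base.wL c.cells t| ≤ C₀ := fun t ↦ by
    rw [hC₀]; exact abs_cellsGamma₂_le_bndMax hcells t
  set ind : ℝ → ℝ := Set.indicator (Icc (-(c.base.T : ℝ)) c.base.T) (fun _ ↦ (1 : ℝ)) with hind
  have hind01 : ∀ t, 0 ≤ ind t ∧ ind t ≤ 1 := fun t ↦ by
    rw [hind]; by_cases ht : t ∈ Icc (-(c.base.T : ℝ)) c.base.T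
    · rw [Set.indicator_of_mem ht]; norm_num
    · rw [Set.indicator_of_notMem ht]; norm_num
  have hindm : Measurable ind := by rw [hind]; exact measurable_const.indicator measurableSet_Icc
  set PiT : ℝ := ∫ t : ℝ, ‖weilMellin g (1 / 2 + t * I)‖ ^ 2 * ind t with hPiT
  have hiPiT : Integrable fun t : ℝ ↦ ‖weilMellin g (1 / 2 + t * I)‖ ^ 2 * ind t :=
    integrable_norm_sq_weilMellin_mul hg hindm (A := 1) (B := 0) zero_le_one le_rfl fun t ↦ by
      rw [zero_mul, add_zero, abs_of_nonneg (hind01 t).1]; exact (hind01 t).2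
  obtain ⟨BΓ, hBΓ0, hBΓ⟩ := exists_abs_cellsGamma₂_le c.base.wL c.cells
  have hiΓ : Integrable fun t : ℝ ↦ ‖weilMellin g (1 / 2 + t * I)‖ ^ 2 * cellsGamma₂ c.base.wL c.cells t :=
    integrable_norm_sq_weilMellin_mul hg (measurable_cellsGamma₂ _ _) hBΓ0 le_rfl (B := 0)
      (fun t ↦ by simpa using hBΓ t)
  have hPiT0 : 0 ≤ PiT := integral_nonneg fun t ↦ mul_nonneg (sq_nonneg _) (hind01 t).1
  have hPiTle : PiT ≤ 7 * N2 := by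
    have h1 : PiT ≤ ∫ t : ℝ, ‖weilMellin g (1 / 2 + t * I)‖ ^ 2 :=
      integral_mono hiPiT (integrable_norm_sq_weilMellin_half_line hg) fun t ↦ by
        simpa using mul_le_mul_of_nonneg_left (hind01 t).2 (sq_nonneg ‖weilMellin g (1 / 2 + t * I)‖)
    rw [integral_norm_sq_weilMellin_half_line hg] at h1
    have h7 : 2 * π ≤ 7 := by linarith [Real.pi_lt_d2]
    nlinarith
  -- `Γ₊ = Γ + C₀ PiT ≥ 0`
  have hΓplus : 0 ≤ Γ + C₀ * PiT := by
    rw [hΓ, hPiT, ← integral_const_mul, ← integral_add hiΓ (hiPiT.const_mul _)]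
    refine integral_nonneg fun t ↦ ?_
    rw [show ‖weilMellin g (1 / 2 + t * I)‖ ^ 2 * cellsGamma₂ c.base.wL c.cells t +
        C₀ * (‖weilMellin g (1 / 2 + t * I)‖ ^ 2 * ind t) =
        ‖weilMellin g (1 / 2 + t * I)‖ ^ 2 * (cellsGamma₂ c.base.wL c.cells t + C₀ * ind t) by ring]
    refine mul_nonneg (sq_nonneg _) ?_
    by_cases ht : t ∈ Icc (-(c.base.T : ℝ)) c.base.T
    · have : ind t = 1 := by rw [hind, Set.indicator_of_mem ht]
      rw [this, mul_one]
      linarith [neg_abs_le (cellsGamma₂ c.base.wL c.cells t), hγabs t]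
    · have : ind t = 0 := by rw [hind, Set.indicator_of_notMem ht]
      have hT' : (c.base.T : ℝ) ≤ |t| := by
        rw [Set.mem_Icc, not_and_or, not_le, not_le] at ht
        rcases ht with ht | ht
        · linarith [neg_abs_le t, le_abs_self t, neg_le_abs t]
        · exact ht.le.trans (le_abs_self t)
      rw [this, mul_zero, add_zero, cellsGamma₂_eq_zeroV hcells hT']
  have hΓlow : -(q * (∑ k ∈ range n, ∑ l ∈ range n, WeilCert3.gHat c k l * z k l +
      5 * L ^ 2 * (c.nuPrimeAbs : ℝ))) - (q - qLo) * C₀ * (7 * N2) ≤ -(1 / (2 * π) * Γ) := by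
    have e : -(1 / (2 * π) * Γ) = -(1 / (2 * π)) * (Γ + C₀ * PiT) + 1 / (2 * π) * (C₀ * PiT) := by ring
    rw [e]
    have h1 : -q * (Γ + C₀ * PiT) ≤ -(1 / (2 * π)) * (Γ + C₀ * PiT) := by nlinarith
    have h2 : qLo * (C₀ * PiT) ≤ 1 / (2 * π) * (C₀ * PiT) :=
      mul_le_mul_of_nonneg_right hqLo1 (mul_nonneg hC₀0 hPiT0)
    have h3 : q * Γ ≤ q * (∑ k ∈ range n, ∑ l ∈ range n, WeilCert3.gHat c k l * z k l +
        5 * L ^ 2 * (c.nuPrimeAbs : ℝ)) := mul_le_mul_of_nonneg_left hC hq0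
    have hqq : 0 ≤ q - qLo := by linarith [invTwoPiLo20_le_invTwoPiHi20]
    have h4 : (q - qLo) * C₀ * PiT ≤ (q - qLo) * C₀ * (7 * N2) :=
      mul_le_mul_of_nonneg_left hPiTle (mul_nonneg hqq hC₀0)
    nlinarith
  -- combine A, B, C
  have hB' : (c.base.wL : ℝ) * N2 - 1 / (2 * π) * Γ ≤ 1 / (2 * π) * A := by
    calc (c.base.wL : ℝ) * N2 - 1 / (2 * π) * Γ = 1 / (2 * π) * ((c.base.wL : ℝ) * (2 * π * N2) - Γ) := by
          field_simp
      _ ≤ 1 / (2 * π) * A := mul_le_mul_of_nonneg_left hB hpi.le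
  have h5 : Real.log π * N2 ≤ ((logPiHi20 : ℚ) : ℝ) * N2 := mul_le_mul_of_nonneg_right hlogpi hN20
  have step1 : ∑ k ∈ range n, ∑ l ∈ range n,
      ((if k % 2 = l % 2 then
        (-1 : ℝ) ^ k * 2 * ((a / 2) ^ k / k.factorial) * ((a / 2) ^ l / l.factorial) else 0) -
        q * WeilCert3.gHat c k l) * z k l +
      ((c.base.wL : ℝ) - (logPiHi20 : ℚ) - 7 * (q - qLo) * C₀) * N2 -
      ((8 * ρ + 6 * ρ ^ 2) + 5 * q * (c.nuPrimeAbs : ℝ)) * L ^ 2 ≤ P - Real.log π * N2 + 1 / (2 * π) * A := by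
    have e1 : ∑ k ∈ range n, ∑ l ∈ range n,
        ((if k % 2 = l % 2 then
          (-1 : ℝ) ^ k * 2 * ((a / 2) ^ k / k.factorial) * ((a / 2) ^ l / l.factorial) else 0) -
          q * WeilCert3.gHat c k l) * z k l =
        ∑ k ∈ range n, ∑ l ∈ range n,
          (if k % 2 = l % 2 then
            (-1 : ℝ) ^ k * 2 * ((a / 2) ^ k / k.factorial) * ((a / 2) ^ l / l.factorial) else 0) * z k l -
        q * ∑ k ∈ range n, ∑ l ∈ range n, WeilCert3.gHat c k l * z k l := by
      rw [Finset.mul_sum, ← Finset.sum_sub_distrib]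
      refine Finset.sum_congr rfl fun k _ ↦ ?_
      rw [Finset.mul_sum, ← Finset.sum_sub_distrib]
      refine Finset.sum_congr rfl fun l _ ↦ ?_
      ring
    rw [e1]
    linarith [hPA, hB', hΓlow, h5]
  -- rounding of the matrix and of the moment table, together: `|prQ − Pexact| ≤ δ`
  have hMk : ∀ k, ‖M k‖ ≤ L := fun k ↦ norm_weilMoment_le hg ha hsupp' k
  set q6 : ℝ := ((invTwoPiHi : ℚ) : ℝ) with hq6
  have hq60 : 0 ≤ q6 := invTwoPiHi_nonneg
  set δ : ℝ := 1 / 2 ^ c.base.pg + q6 * (1 / 2 ^ c.pnu) with hδ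
  have hδ0 : 0 ≤ δ := by rw [hδ]; positivity
  have hround : ∑ k ∈ range n, ∑ l ∈ range n, ((c.base.prQ nu k l : ℚ) : ℝ) * z k l -
      ∑ k ∈ range n, ∑ l ∈ range n,
        ((if k % 2 = l % 2 then
          (-1 : ℝ) ^ k * 2 * ((a / 2) ^ k / k.factorial) * ((a / 2) ^ l / l.factorial) else 0) -
          q * WeilCert3.gHat c k l) * z k l ≤ δ * (n : ℝ) ^ 2 * L ^ 2 := by
    refine WeilCert3.quad_rounding_le' n (fun k l ↦ ((c.base.prQ nu k l : ℚ) : ℝ)) _ δ L hδ0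
      (fun k hk l hl ↦ ?_) M hMk
    have h1 : |((c.base.prQ nu k l : ℚ) : ℝ) - ((c.base.pmQ nu k l : ℚ) : ℝ)| ≤ 1 / 2 ^ c.base.pg := by
      rw [abs_sub_comm]
      unfold WeilCert.prQ
      exact abs_cast_sub_ratRd_le c.base.pg (c.base.pmQ nu k l)
    have h2q := WeilCert3.abs_pmQ_sub_pmQexact_le hnuchk (by omega : k < c.base.N + 1)
      (by omega : l < c.base.N + 1)
    have h2 : |((c.base.pmQ nu k l : ℚ) : ℝ) - ((WeilCert3.pmQexact c k l : ℚ) : ℝ)| ≤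
        q6 * (1 / 2 ^ c.pnu) := by
      have h := (Rat.cast_le (K := ℝ)).2 h2q
      rw [hnu, hq6]
      push_cast at h ⊢
      exact h
    have h3 : ((WeilCert3.pmQexact c k l : ℚ) : ℝ) =
        (if k % 2 = l % 2 then
          (-1 : ℝ) ^ k * 2 * ((a / 2) ^ k / k.factorial) * ((a / 2) ^ l / l.factorial) else 0) -
          q * WeilCert3.gHat c k l := by
      rw [WeilCert3.pmQexact_cast, ha_def, hq]
    rw [hδ, ← h3]
    exact (abs_sub_le _ _ _).trans (add_le_add h1 h2)
  -- κ_exact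
  have hcoef : 0 ≤ (8 * ρ + 6 * ρ ^ 2) + 5 * q * (c.nuPrimeAbs : ℝ) + δ * (n : ℝ) ^ 2 :=
    add_nonneg (add_nonneg (by positivity) (mul_nonneg (mul_nonneg (by norm_num) hq0) hν0)) (by positivity)
  have hkex : ((c.kappaExact : ℚ) : ℝ) =
      ((c.base.wL : ℝ) - (logPiHi20 : ℚ) - 7 * (q - qLo) * C₀) -
        2 * a * ((8 * ρ + 6 * ρ ^ 2) + 5 * q * (c.nuPrimeAbs : ℝ) + δ * (n : ℝ) ^ 2) := by
    rw [hρ, hq, hqLo, hC₀, hn, ha_def, hδ, hq6]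
    unfold WeilCert3.kappaExact WeilCert.etaP WeilCert.rhoE
    push_cast
    ring
  have hκle : ((c.kappaQ : ℚ) : ℝ) ≤ ((c.kappaExact : ℚ) : ℝ) := by
    unfold WeilCert3.kappaQ; exact_mod_cast ratRd_le c.base.pg _
  -- E ≥ Σ pr z + κ N2
  have step3 : ∑ k ∈ range n, ∑ l ∈ range n, ((c.base.prQ nu k l : ℚ) : ℝ) * z k l +
      ((c.kappaQ : ℚ) : ℝ) * N2 ≤ P - Real.log π * N2 + 1 / (2 * π) * A := by
    have h1 : ((c.kappaQ : ℚ) : ℝ) * N2 ≤ ((c.kappaExact : ℚ) : ℝ) * N2 :=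
      mul_le_mul_of_nonneg_right hκle hN20
    rw [hkex] at h1
    have h2 := mul_le_mul_of_nonneg_left hL1 hcoef
    linarith [step1, hround, h1, h2]
  exact step3

end GroundStateSimpleEven

set_option maxHeartbeats 1600000 in
set_option linter.dupNamespace false in
/-- **Soundness of the odd-sector margin certificate.** If a Stage-C-format certificate `c` passes
the cells, scalar and moment checks and its ODD block passes `checkBlockK` with a Bessel coefficient
`κ'`, `0 ≤ κ' ≤ κ(c)`, then every ODD test function `g` on `[-b, b]` has
`(κ(c) − κ') ‖g‖₂² ≤ E₂(g)` (`E₂ = weilFirstPrimeQuadratic`). For odd `g` the even moments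
`M_{2i} = ∫ g (x/a₀)^{2i}` vanish, so only the odd block enters the algebraic core; `oms_step3` gives
`Σ P_r z + κ ‖g‖₂² ≤ E₂(g)`, Bessel is applied with the coefficient `κ' ≥ 0`, and the difference
`(κ − κ') ‖g‖₂²` is the margin. [folklore] -/
theorem stub_oddMarginSound :
    ∀ (c : WeilCert3) (κ' : ℚ),
      checkCells₃ c.base.prec c.j c.base.wL c.base.T c.base.mwT c.cells = true →
      c.checkScalars = true → c.checkNu = true →
      c.base.checkBlockK c.nuTab κ' 1 = true → 0 ≤ κ' → κ' ≤ c.kappaQ →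
      ∀ g : ℝ → ℂ, IsWeilTest g → tsupport g ⊆ Icc (-(c.b : ℝ)) c.b → (∀ x, g (-x) = -g x) →
        ((c.kappaQ - κ' : ℚ) : ℝ) * weilNorm2Sq g ≤ weilFirstPrimeQuadratic g := by
  intro c κ' hcells3 hsc hnuchk hb1 hκ'0 _hκ'le g hg hsupp hodd
  obtain ⟨-, hbpos, hba, -, -, -, -, hN, -⟩ := WeilCert3.scalars_spec hsc
  have hb0' : (0 : ℝ) < c.b := by exact_mod_cast hbpos
  have hba' : ((c.b : ℚ) : ℝ) ≤ (c.base.a0 : ℝ) := by exact_mod_cast hba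
  have ha : (0 : ℝ) < (c.base.a0 : ℝ) := by linarith
  have hsupp' : tsupport g ⊆ Icc (-(c.base.a0 : ℝ)) c.base.a0 :=
    hsupp.trans (Icc_subset_Icc (by linarith) hba')
  have step3 := GroundStateSimpleEven.oms_step3 hcells3 hsc hnuchk hg hsupp
  have hbes := weilNorm2Sq_ge_bessel hg ha hsupp' (c.base.N + 1)
    (c.base.uVec (weilMoment c.base.a0 g))
  have hcore := GroundStateSimpleEven.oms_core_nonnegK_odd (nu := c.nuTab) (κ := κ') hN hb1 _ rfl
    (weilMoment c.base.a0 g) fun i ↦ GroundStateSimpleEven.oms_weilMoment_even hodd _ i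
  have h4 := mul_le_mul_of_nonneg_left hbes (show (0 : ℝ) ≤ ((κ' : ℚ) : ℝ) by exact_mod_cast hκ'0)
  push_cast
  linarith


end Summit.RiemannHypothesis.RiemannHypothesis.Theorems
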